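import Summits.BirchSwinnertonDyer.BirchSwinnertonDyer.Theorems.SemiOrdinaryEisensteinDescentShaTwoCochainBridgeData
import Summits.BirchSwinnertonDyer.BirchSwinnertonDyer.Theorems.SemiOrdinaryEisensteinDescentShaTwoCochainBridgeDataPlace
import Literature.NumberTheory.EllipticCurves.CasselsTateGeneralCaseKernel
import Literature.NumberTheory.GaloisRepresentations.ContinuousCupProductCompat
import HarnessLib

/-!
# The Ш²-cochain bridge, PACKAGED IN `μₙ`-CURRENCY: the bridge's admissible choice `(H♭; φ♭_v)` for the evaluation pairing
# `Hom(M, μₙ) × M → μₙ` of `(F♭, γ)`, `Ψ h = [F♭]`, in the exact hypothesis shapes of the choice-independence file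
# `…ShaTwoCochainPairChoiceIndependence` (S1′), with `ι_v ∘ κ` of its local `2`-cocycles equal to `π_v Z − dλ_v` ON THE NOSE
# (step S2♭ of SHA2-BRIDGE-w3g7)

Route `SemiOrdinaryEisensteinDescent` (BSD), Kolyvagin column, Cassels–Tate lane: print item `CasselsTateLevelInputsFact`
(stmt-BirchSwinnertonDyer-20191), binder `hbridge` of `ShaTwoCochainTheta.casselsTate_levelInputs_of_readout_vanishing` (p638776).
Companion of `…ShaTwoCochainBridgePackage` (p640393, the `K̄ˣ`-currency package).  The glue compares `hPTc`'s admissible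
choice (transported by step E, p638209, to the evaluation pairing `(tateDualPairing ρ n).flip` and the cocycle `F♭`) with the
bridge's choice through S1′ (p635677), which speaks `μₙ(K̄)`-valued cochains: a global `H♭ : C(Γ_K², μₙ)` with
`(F♭ ∪ γ) = dH♭` and local `φ♭_v : C(Γ_v, Hom(M, μₙ))` with `F♭|_v = dφ♭_v`.  This file produces them from the SAME
construction as the `K̄ˣ`-package (so the idèle cocycle `Z` and its class image `h ∘ c` are shared), reading the bridge's
`Hom(M, K̄_vˣ)`-valued primitive `φ_v` back into `Hom(M, μₙ(K̄))` through `κ_v⁻¹ ∘ μ-transfer⁻¹`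
(`homMuUnitsInv`, `muTransferEquiv`; `M` is `n`-torsion, `ι_v ∘ κ = κ_v ∘ μ-transfer` is injective).

* **`exists_bridgePackageMu`** — for `ρ` finite `n`-torsion (`hM`), `H³(K, μₙ) = 0`, `h : N₁ ⟶ C̄`, `γ ∈ Z¹(K, M)`, THERE ARE
  `F♭ ∈ Z²(K, M^D)`, `H♭ : C(Γ_K², μₙ)`, `c ∈ Z²(K, N₁)`, `h̃`, `Z ∈ Z²(K, J̄)` with
  (1♭) `Ψ h = [F♭]`; (2♭) `((tateDualPairing ρ n).flip.cupCocycle₂₁ F♭ γ)(σ,τ,υ) = dH♭(σ,τ,υ)` (S1′'s `hh`);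
  (3) `jC ∘ h̃ = h`; (4) `δ₁[γ] = [c]`; (5) `jC (Z(σ,τ)) = h (c(σ,τ))`;
  (6♭) at every place `v` and idèle projection `π_v`: `φ♭_v : C(Γ_v, Hom(M, μₙ))` with S1′'s `hφ`-shape
  `F♭|_v(σ',τ') = σ'⋆φ♭_v(τ') − φ♭_v(σ'τ') + φ♭_v(σ')` and `λ_v : C(Γ_v, K̄_vˣ)` with
  `ι_v (κ (φ♭_v(σ')(σ' γ(θτ')) − H♭(θσ',θτ'))) = π_v Z(θσ',θτ') − (σ'λ_v(τ') − λ_v(σ'τ') + λ_v(σ'))`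
  (`ι_v = unitsTransferAddHom K K_v`, `κ = kummerInclAddHom K n`; the left argument is the value of S1′'s local `2`-cocycle
  `cupSubCocycle` for the restricted evaluation pairing).

Width seat `bsd-wall-soed-p2-w3` g7; `--supports stmt-BirchSwinnertonDyer-20480`, helper.  THEOREMS ONLY; no case of BSD,
Poitou–Tate or Cassels–Tate is proved here.

## References
* [MilneADT2006] J. S. Milne, *Arithmetic Duality Theorems*, 2nd ed. (2006), I §0 (0.8), Thm. 4.10 (a) (proof, p. 58),
  Lemma 4.13, §6 proof of Prop. 6.9.
* [NeukirchSchmidtWingberg2008] J. Neukirch, A. Schmidt, K. Wingberg, *Cohomology of Number Fields*, 2nd ed. (2008), (1.3.2),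
  Prop. 1.4.1, (1.5.2).
* [SerreGaloisCohomology1997] J.-P. Serre, *Galois Cohomology* (1997), I §2.2, II §1.2.
-/

noncomputable section

-- `Summit.<P>.<Sub>` repeats `BirchSwinnertonDyer` by the tree's layout convention (D-0017)
set_option linter.dupNamespace false
set_option autoImplicit false

namespace Summit.BirchSwinnertonDyer.BirchSwinnertonDyer.Theorems.ShaTwoCochain

open CategoryTheory NumberField Function
open Literature.NumberTheory.EllipticCurves
open Literature.NumberTheory.GaloisRepresentations Literature.NumberTheory.GaloisRepresentations.HomDual
open Literature.Algebra.Homology Literature.Algebra.Homology.DiscreteRep ContRepresentation Field Literature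
open Literature.NumberTheory.GaloisRepresentations.DiscreteGaloisModule (units UnitsCarrier mu MuCarrier TateDual tateDual
  tateDualPairing)
open Literature.NumberTheory.GaloisRepresentations.IdeleClassBar (classBarD)
open Literature.NumberTheory.GaloisRepresentations.FreePresentation
open Literature.NumberTheory.GaloisRepresentations.DGMBridge
open scoped ContRepresentation

variable {K : Type} [Field K] [NumberField K]
variable {M : Type} [AddCommGroup M] [TopologicalSpace M] [DiscreteTopology M] [Finite M]
variable (ρ : DiscreteGaloisModule K M) (n : ℕ) [NeZero n] (hM : ∀ m : M, n • m = 0)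

/-- **The Ш²-cochain bridge, packaged in `μₙ`-currency** — see the module docstring for the conjuncts (1♭)–(6♭).
[cite: MilneADT2006, I Thm. 4.10 (a) (proof, p. 58), Lemma 4.13][cite: NeukirchSchmidtWingberg2008, (1.3.2), Prop. 1.4.1, (1.5.2)] -/
theorem exists_bridgePackageMu (hH3 : ∀ z : galoisCohomology (mu K n) 3, z = 0)
    (h : (presentationComplex ρ).X₁ ⟶ classBarD K) (γ : contOneCocycles ρ.toTopRep) :
    haveI := moduleFinite_presModule₁ ρ
    haveI := moduleFinite_presModule₂ ρ
    haveI := absoluteGaloisGroup_compactSpace K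
    ∃ (Fb : contTwoCocycles (ρ.tateDual n).toTopRep)
      (Hb : C(absoluteGaloisGroup K × absoluteGaloisGroup K, MuCarrier K n))
      (c : contTwoCocycles (presModule₁ ρ).toTopRep)
      (ht : DiscreteRep.HomCarrier (LCarrier (presentationComplex ρ).X₁) (LCarrier (ideleBarD K)))
      (Z : contTwoCocycles (toDGM (ideleBarD K)).toTopRep),
      -- (1♭) `Ψ h = [F♭]`
      shaTwoConnecting ρ n hM h = twoCocycleClass _ Fb ∧
      -- (2♭) `dH♭ = F♭ ∪ γ` for the evaluation pairing (S1′'s `hh`)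
      (∀ σ τ υ : absoluteGaloisGroup K,
        ((tateDualPairing ρ n).flip.cupCocycle₂₁ Fb γ).1 (σ, τ, υ) = dTwo (mu K n).toTopRep Hb σ τ υ) ∧
      -- (3) `h̃` lifts `h` along `J̄ → C̄`
      (∀ x : LCarrier (presentationComplex ρ).X₁,
        ideleToClassI K ((show _ →ₗ[ℤ] LCarrier (ideleBarD K) from ht) x) =
          lmap (presentationComplex ρ).X₁ (classBarD K) h x) ∧
      -- (4) `[c] = δ₁[γ]` for `0 → N₁ → P → M → 0`
      (pres_isSES ρ).δ₁ (oneCocycleClass _ γ) = twoCocycleClass _ c ∧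
      -- (5) the idèle-class image of `Z` is `h ∘ c`
      (∀ σ τ : absoluteGaloisGroup K,
        ideleToClassI K (Z.1 (σ, τ)) = lmap (presentationComplex ρ).X₁ (classBarD K) h (c.1 (σ, τ))) ∧
      -- (6♭) the local primitives in `μₙ`-currency (S1′'s `hφ`) and the comparison with `π_v Z`, on the nose
      (∀ (v : Place K) (π : HomDual.IdeleProjection K v),
        ∃ (φb : C(absoluteGaloisGroup (Place.Completion v), TateDual K M n))
          (lam : C(absoluteGaloisGroup (Place.Completion v), UnitsCarrier (Place.Completion v))),
          (∀ σ' τ' : absoluteGaloisGroup (Place.Completion v),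
            (resTwo (ρ.tateDual n) (Place.Completion v) Fb).1 (σ', τ') =
              (DiscreteGaloisModule.toTopRep (GaloisRep.restrictField (Place.Completion v) (ρ.tateDual n))).ρ σ' (φb τ') -
                φb (σ' * τ') + φb σ') ∧
          (∀ σ' τ' : absoluteGaloisGroup (Place.Completion v),
            unitsTransferAddHom K (Place.Completion v) (kummerInclAddHom K n
                ((show MuCarrier K n from
                    (φb σ') (ρ (absGaloisRestrict K (Place.Completion v) σ') (γ.1 (absGaloisRestrict K (Place.Completion v) τ')))) -
                  Hb (absGaloisRestrict K (Place.Completion v) σ', absGaloisRestrict K (Place.Completion v) τ'))) =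
            (π.toAddMonoidHom.comp (LCarrier.val (ideleBarD K)))
                (Z.1 (absGaloisRestrict K (Place.Completion v) σ', absGaloisRestrict K (Place.Completion v) τ')) -
              (units (Place.Completion v) σ' (lam τ') - lam (σ' * τ') + lam σ'))) := by
  haveI := moduleFinite_presModule₁ ρ
  haveI := moduleFinite_presModule₂ ρ
  haveI := absoluteGaloisGroup_compactSpace K
  -- the global data (G): `h̃, ξ, ξ̃, F`
  obtain ⟨ht, ξ, ξt, F, -, -, hht, hξ, hξt, hF, -, -, hΨ⟩ := exists_bridgeGlobalData ρ n hM h γ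
  -- `F♭ := e⁻¹ ∘ F`
  let Fb : contTwoCocycles (ρ.tateDual n).toTopRep :=
    contTwoCocycles.pullback (ContinuousMonoidHom.id _) (resIdHom (tateDualUnitsIso K ρ n hM).inv) F
  have hFb : ∀ (σ τ : absoluteGaloisGroup K) (m : M),
      kummerInclAddHom K n ((Fb.1 (σ, τ)) m) = (show M →ₗ[ℤ] UnitsCarrier K from F.1 (σ, τ)) m := by
    intro σ τ m
    have e1 : (tateDualUnitsIso K ρ n hM).hom.hom ((tateDualUnitsIso K ρ n hM).inv.hom (F.1 (σ, τ))) = F.1 (σ, τ) := by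
      rw [← TopRep.comp_apply, (tateDualUnitsIso K ρ n hM).inv_hom_id]
      rfl
    exact congrArg (fun Φ : DiscreteRep.HomCarrier M (UnitsCarrier K) => (show M →ₗ[ℤ] UnitsCarrier K from Φ) m) e1
  have hΨb : shaTwoConnecting ρ n hM h = twoCocycleClass _ Fb := by
    rw [hΨ, cohomologyMap_twoCocycleClass]
  -- `H♭` from `H³(K, μₙ) = 0`, and `H := κ ∘ H♭`
  obtain ⟨Hb, hHb⟩ := (threeCocycleClass_eq_zero_iff_dTwo _ _).1
    (hH3 (threeCocycleClass _ (((tateDualPairing ρ n).flip).cupCocycle₂₁ Fb γ)))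
  let H : C(absoluteGaloisGroup K × absoluteGaloisGroup K, UnitsCarrier K) :=
    ⟨fun q => (kummerι K n).hom (Hb q), (kummerι K n).hom.toContinuousLinearMap.continuous.comp Hb.continuous⟩
  have hH : ∀ σ τ υ : absoluteGaloisGroup K,
      (show M →ₗ[ℤ] UnitsCarrier K from F.1 (σ, τ)) (ρ (σ * τ) (γ.1 υ)) = dTwo (units K).toTopRep H σ τ υ := by
    intro σ τ υ
    have hι : ∀ x, (units K) σ ((kummerι K n).hom x) = (kummerι K n).hom ((mu K n) σ x) :=
      fun x => (ContinuousRep.hom_comm_apply (kummerι K n) σ x).symm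
    have hd : dTwo (units K).toTopRep H σ τ υ = (kummerι K n).hom (dTwo (mu K n).toTopRep Hb σ τ υ) := by
      simp only [H, dTwo_apply, ContinuousMap.coe_mk, map_sub, map_add, ContinuousRep.toContRepresentation_apply_apply, hι]
    rw [hd, ← hHb, ContPairing.cupCocycle₂₁_apply, ContPairing.flip_toLin_apply, contOneCocycles.apply_mul_sub]
    exact (hFb σ τ _).symm
  -- the canonical lift `γ̃` of `γ` and its connecting cocycle `c`, with `δ₁[γ] = [c]`
  let γt : C(absoluteGaloisGroup K, LCarrier (presentationComplex ρ).X₂) := (pres_isSES ρ).liftCocycle γ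
  let c : contTwoCocycles (presModule₁ ρ).toTopRep :=
    (pres_isSES ρ).connectingCocycle γt ((pres_isSES ρ).liftCocycle_isLift γ)
  have hγt : ∀ σ : absoluteGaloisGroup K, presProj ρ (γt σ) = γ.1 σ := fun σ => (pres_isSES ρ).g_liftCocycle_apply γ σ
  have hc : ∀ σ τ : absoluteGaloisGroup K,
      presIncl ρ (c.1 (σ, τ)) = (presModule₂ ρ) σ (γt τ) - γt (σ * τ) + γt σ := fun σ τ =>
    (pres_isSES ρ).f_connectingCocycle_apply γt ((pres_isSES ρ).liftCocycle_isLift γ) σ τ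
  have hδ : (pres_isSES ρ).δ₁ (oneCocycleClass _ γ) = twoCocycleClass _ c := by
    have e := (pres_isSES ρ).δ₁_oneCocycleClass γt ((pres_isSES ρ).liftCocycle_isLift γ)
    rw [(pres_isSES ρ).pushCocycle_liftCocycle γ] at e
    exact e
  -- the continuous bridge cochain `B` and the bridge cocycle `Z = B − uJ ∘ H`
  obtain ⟨B, hB⟩ := exists_bridgeCochain ρ ht ξt γt c hc
  let Zc : C(absoluteGaloisGroup K × absoluteGaloisGroup K, LCarrier (ideleBarD K)) :=
    ⟨fun q => B q - unitsToIdeleI K (H q),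
      B.continuous.sub ((unitsToIdeleI K).toContinuousLinearMap.continuous.comp H.continuous)⟩
  have hZ : ∀ σ τ : absoluteGaloisGroup K, Zc (σ, τ) = B (σ, τ) - unitsToIdeleI K (H (σ, τ)) := fun _ _ => rfl
  have hZmem : Zc ∈ contTwoCocycles (toDGM (ideleBarD K)).toTopRep :=
    bridgeCocycle_mem (presIncl ρ) (presProj ρ) (unitsToIdeleI K) ht ξ hξ ξt hξt F.1 hF γ γt hγt c.1 hc c.2 B hB H hH Zc hZ
  have hlift : ∀ x : LCarrier (presentationComplex ρ).X₁,
      ideleToClassI K ((show _ →ₗ[ℤ] LCarrier (ideleBarD K) from ht) x) = lmap (presentationComplex ρ).X₁ (classBarD K) h x := by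
    intro x
    exact congrArg (fun Φ : DiscreteRep.HomCarrier (LCarrier (presentationComplex ρ).X₁) (LCarrier (classBarD K)) =>
      (show _ →ₗ[ℤ] LCarrier (classBarD K) from Φ) x) hht
  have hjU : ∀ u : UnitsCarrier K, ideleToClassI K (unitsToIdeleI K u) = 0 := fun u => (idele_isSES K).g_f_apply u
  refine ⟨Fb, Hb, c, ht, ⟨Zc, hZmem⟩, hΨb, hHb, hlift, hδ, fun σ τ => ?_, fun v π => ?_⟩
  · -- (5)
    rw [← hlift]
    exact idele_class_of_bridgeCocycle (uJ := unitsToIdeleI K) (ideleToClassI K) hjU ht ξt γt c.1 B hB H Zc hZ σ τ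
  · -- (6♭) at the place `v` for `π_v`
    haveI : CharZero (Place.Completion v) := charZero_placeCompletion v
    have hπ := ideleProjection_toDGM_smul π
    obtain ⟨ηt, φ, hηt, hφ⟩ := exists_bridgeLocalData (presIncl ρ) (presProj ρ) (pres_isSES ρ) (unitsToIdeleI K)
      (π.toAddMonoidHom.comp (LCarrier.val (ideleBarD K))) hπ ht ξ ξt hξ hξt
    -- `j = ι_v ∘ κ = κ_v ∘ μ-transfer` intertwines the actions
    have hjsmul : ∀ (σ' : absoluteGaloisGroup (Place.Completion v)) (ζ : MuCarrier K n),
        unitsTransferAddHom K (Place.Completion v) (kummerInclAddHom K n (mu K n (absGaloisRestrict K (Place.Completion v) σ') ζ)) =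
          units (Place.Completion v) σ' (unitsTransferAddHom K (Place.Completion v) (kummerInclAddHom K n ζ)) := by
      intro σ' ζ
      rw [← unitsTransferAddHom_smul]
      exact congrArg (unitsTransferAddHom K (Place.Completion v))
        (ContinuousRep.hom_comm_apply (kummerι K n) (absGaloisRestrict K (Place.Completion v) σ') ζ)
    -- the `μₙ`-reading `φ♭` of `φ`: `j ∘ φ♭(σ') = φ(σ')`
    let ψ : DiscreteRep.HomCarrier M (UnitsCarrier (Place.Completion v)) → TateDual K M n := fun G =>
      (show TateDual K M n from
        ((muTransferEquiv K (Place.Completion v) n).symm.toAddMonoidHom.comp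
          (show M →+ MuCarrier (Place.Completion v) n from homMuUnitsInv (Place.Completion v) n hM G)))
    let φb : C(absoluteGaloisGroup (Place.Completion v), TateDual K M n) :=
      ⟨ψ ∘ φ, (continuous_of_discreteTopology (f := ψ)).comp φ.continuous⟩
    have hφb : ∀ (σ' : absoluteGaloisGroup (Place.Completion v)) (m : M),
        unitsTransferAddHom K (Place.Completion v) (kummerInclAddHom K n ((φb σ') m)) =
          (show M →ₗ[ℤ] UnitsCarrier (Place.Completion v) from φ σ') m := by
      intro σ' m
      change unitsTransferAddHom K (Place.Completion v) (kummerInclAddHom K n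
        ((muTransferEquiv K (Place.Completion v) n).symm
          ((show M →+ MuCarrier (Place.Completion v) n from homMuUnitsInv (Place.Completion v) n hM (φ σ')) m))) = _
      rw [unitsTransferAddHom_kummerInclAddHom, ← muTransferEquiv_apply, AddEquiv.apply_symm_apply]
      exact congrArg (fun Φ : DiscreteRep.HomCarrier M (UnitsCarrier (Place.Completion v)) =>
        (show M →ₗ[ℤ] UnitsCarrier (Place.Completion v) from Φ) m)
        (homMuUnits_homMuUnitsInv (Place.Completion v) n hM (show M →ₗ[ℤ] UnitsCarrier (Place.Completion v) from φ σ'))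
    have hj : Function.Injective (fun ζ : MuCarrier K n =>
        unitsTransferAddHom K (Place.Completion v) (kummerInclAddHom K n ζ)) := by
      intro ζ₁ ζ₂ hζ
      dsimp only at hζ
      rw [unitsTransferAddHom_kummerInclAddHom, unitsTransferAddHom_kummerInclAddHom] at hζ
      exact muTransfer_injective K _ n (kummerInclAddHom_injective _ n hζ)
    refine ⟨φb, ⟨fun σ' => (show _ →ₗ[ℤ] UnitsCarrier (Place.Completion v) from ηt)
        (γt (absGaloisRestrict K (Place.Completion v) σ')),
      (continuous_of_discreteTopology (f := fun y : LCarrier (presentationComplex ρ).X₂ =>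
        (show _ →ₗ[ℤ] UnitsCarrier (Place.Completion v) from ηt) y)).comp
        (γt.continuous.comp (absGaloisRestrict K (Place.Completion v)).continuous)⟩,
      fun σ' τ' => ?_, fun σ' τ' => ?_⟩
    · -- `F♭|_v = dφ♭` : test against the injective `j`, pointwise in `z = p y`
      refine TateDual.ext fun z => hj ?_
      obtain ⟨y, hy⟩ := (pres_isSES ρ).surjective z
      change presProj ρ y = z at hy
      have h6a := dOne_bridgePrimitive (presProj ρ) (unitsToIdeleI K)
        (π.toAddMonoidHom.comp (LCarrier.val (ideleBarD K))) hπ ξt F.1 hF ηt φ hφ σ' τ' y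
      rw [hy, ideleProjection_unitsToIdeleI π, unitsTransfer_apply] at h6a
      change units (Place.Completion v) σ' ((show M →ₗ[ℤ] UnitsCarrier (Place.Completion v) from φ τ')
          (ρ (absGaloisRestrict K (Place.Completion v) σ'⁻¹) z)) - _ + _ = _ at h6a
      rw [map_inv, ← hφb, ← hφb, ← hφb, ← hjsmul, ← map_sub, ← map_sub, ← map_add, ← map_add] at h6a
      dsimp only
      rw [resTwo_apply, hFb]
      exact h6a.symm
    · -- `j (φ♭ ∪ γ − H♭) = π_v Z − dλ`
      have h6b := bridgeLocalCocycle_eq (presIncl ρ) (presProj ρ) (unitsToIdeleI K)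
        (π.toAddMonoidHom.comp (LCarrier.val (ideleBarD K))) ht ξt γ γt hγt c.1 hc B hB H Zc hZ ηt hηt φ hφ σ' τ'
      rw [ideleProjection_unitsToIdeleI π, unitsTransfer_apply] at h6b
      rw [map_sub, map_sub, hφb]
      exact h6b

end Summit.BirchSwinnertonDyer.BirchSwinnertonDyer.Theorems.ShaTwoCochain

end
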